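import Summits.BirchSwinnertonDyer.Rank1Residual.GaloisImage.PropagatedConditionCoisotropic
import Literature.NumberTheory.GaloisRepresentations.ContinuousH1OrderTwo
import Literature.NumberTheory.GaloisRepresentations.LocalGlobalCohomologyDualityProofs
import HarnessLib

/-!
# The residual self-duality COUNT of the classical `n`-descent structure (odd `n`):
# `#H¹_𝓚(K, E[n]) = #H¹_{𝓚^*}(K, E[n]^D)`
# (cell `b2b-bsdres`, team n1011, row T-a3-F1 core rank — discharging the binder `hKSD` of
# `PropagatedStructureCoreRank.hasCoreRank_one_propagatedSelmerStructureOne`)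

Honest framing of the cell: research route; theorems only; no named fact is minted.  CONDITIONAL on
Tate's local Euler–Poincaré characteristic formula at the finite places (`hEP`, named fact
`localEulerPoincareCharacteristic`, Milne ADT I Thm. 2.8 — taken as a hypothesis exactly as in
n1011-p18's `PropagatedConditionCoisotropic`) and on the injectivity of the local invariant maps.

For an elliptic curve `E` over a number field `K`, an ODD prime power `n`, Weil pairing data `e`
on `E[n]` (alternating, non-degenerate, Galois equivariant) with its transport
`θ = weilDualIntertwining : E[n] → E[n]^D` and inverse `θ⁻¹ = weilDualInv` (X11b `WeilTransport`),
and the Kummer structure `𝓚 = kummerSelmerStructure n`:  `θ_*` maps `H¹_𝓚(K, E[n])` into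
`H¹_{𝓚^*}(K, E[n]^D)` and `θ⁻¹_*` maps back (at finite places `θ⁻¹(𝓚_v^*) = 𝓚_v` is n1011-p18's
`dualTransported_kummerSelmerStructure_inr`; at infinite places both cohomology groups vanish for
odd `n`), both injectively; hence, when `H¹_𝓚(K, E[n]) = Sel^{(n)}(E/K)` is finite, the two Selmer
groups have the same order (`natCard_selmerGroup_kummer_eq_dual`).

References: Sakamoto 2024 §3.1.2 (residual self-duality), Def. 3.9; Milne ADT I Cor. 3.4, Thm. 2.8.
-/

noncomputable section

open scoped Classical ContRepresentation
open Function Field NumberField IsDedekindDomain WeierstrassCurve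
open Literature.NumberTheory.EllipticCurves Literature.NumberTheory.GaloisRepresentations
  Literature.NumberTheory.GaloisRepresentations.DiscreteGaloisModule Literature.NumberTheory.GaloisCohomology
open Summit.BirchSwinnertonDyer.Rank1Residual.X11b.Levels Summit.BirchSwinnertonDyer.Rank1Residual.X11b.LocBridge

universe u

namespace Summit.BirchSwinnertonDyer.Rank1Residual.GaloisImage

variable {K : Type u} [Field K] [NumberField K] (W : WeierstrassCurve K) (n : ℕ) [NeZero n]
  [W.IsElliptic]
variable (e : geomTorsion W n → geomTorsion W n → AlgebraicClosure K)
  (hμ : ∀ S T, e S T ^ n = 1)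
  (hadd₁ : ∀ S₁ S₂ T, e (S₁ + S₂) T = e S₁ T * e S₂ T)
  (hadd₂ : ∀ S T₁ T₂, e S (T₁ + T₂) = e S T₁ * e S T₂)
  (hgal : ∀ (σ : absoluteGaloisGroup K) (S T : geomTorsion W n), σ • e S T = e (σ • S) (σ • T))
  (halt : ∀ T, e T T = 1) (hnondeg : ∀ T, (∀ S, e S T = 1) → T = 0)

attribute [local instance] finite_geomTorsion_of_neZero

omit [NumberField K] [NeZero n] [W.IsElliptic] in
/-- Localisation commutes with the map induced by an intertwining map (the tree's
`galoisCohomology.res_map_one` at `E = K_v`). [folklore] -/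
theorem localization_map_one' [NumberField K] {M₁ M₂ : Type u}
    [AddCommGroup M₁] [TopologicalSpace M₁] [DiscreteTopology M₁]
    [AddCommGroup M₂] [TopologicalSpace M₂] [DiscreteTopology M₂]
    {ρ₁ : DiscreteGaloisModule K M₁} {ρ₂ : DiscreteGaloisModule K M₂}
    (f : ρ₁.toContRepresentation →ⁱL ρ₂.toContRepresentation) (v : Place K) (c : galoisCohomology ρ₁ 1) :
    galoisCohomology.localization ρ₂ v 1 (galoisCohomology.map f 1 c) =
      galoisCohomology.map (f.restrictField (Place.Completion v)) 1
        (galoisCohomology.localization ρ₁ v 1 c) :=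
  galoisCohomology.res_map_one (Place.Completion v) f c

/-- At an infinite place and odd `n`, every class of `H¹(K_w, E[n]^D)` vanishes. [folklore] -/
theorem galoisCohomology_one_tateDual_torsion_eq_zero_infinitePlace_of_odd (hodd : Odd n)
    (w : InfinitePlace K)
    (y : galoisCohomology (GaloisRep.restrictField (Place.Completion (Sum.inl w : Place K))
      ((W.torsionGaloisModule n).tateDual n)) 1) : y = 0 :=
  eq_zero_of_odd_nsmul_eq_zero_infinitePlace w _ hodd y
    (nsmul_continuousCohomology_one_eq_zero _ n
      (fun f : TateDual K (geomTorsion W n) n => DiscreteGaloisModule.TateDual.nsmul_eq_zero f) y)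

include halt hnondeg in
/-- **`θ_*` maps `H¹_𝓚(K, E[n])` into `H¹_{𝓚^*}(K, E[n]^D)`** (odd prime power `n`): at finite places
`𝓚_v = θ⁻¹(𝓚_v^*)` (n1011-p18, from `hEP` and the injectivity of `inv_v`), at infinite places
`H¹ = 0`. [folklore] -/
theorem map_weilDual_mem_dualSelmerGroup (hn : IsPrimePow n) (hodd : Odd n)
    (inv : LocalInvariants K n) (hinv : ∀ v : HeightOneSpectrum (𝓞 K), Injective (inv (Sum.inr v)))
    (hEP : ∀ v : HeightOneSpectrum (𝓞 K), localEulerPoincareCharacteristic (v.adicCompletion K))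
    {x : galoisCohomology (W.torsionGaloisModule n) 1}
    (hx : x ∈ (W.kummerSelmerStructure n).selmerGroup) :
    galoisCohomology.map (weilDualIntertwining W n e hμ hadd₁ hadd₂ hgal) 1 x ∈
      (inv.dualSelmerStructure (W.torsionGaloisModule n) (W.kummerSelmerStructure n)).selmerGroup := by
  rw [SelmerStructure.mem_selmerGroup_iff] at hx ⊢
  intro v
  rw [localization_map_one']
  rcases v with w | v
  · set z := galoisCohomology.map ((weilDualIntertwining W n e hμ hadd₁ hadd₂ hgal).restrictField
      (Place.Completion (Sum.inl w : Place K))) 1 (galoisCohomology.localization _ (Sum.inl w) 1 x)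
    have h0 : z = 0 := galoisCohomology_one_tateDual_torsion_eq_zero_infinitePlace_of_odd W n hodd w z
    rw [h0]; exact zero_mem _
  · have h := hx (Sum.inr v)
    rw [← dualTransported_kummerSelmerStructure_inr W n e hμ hadd₁ hadd₂ hgal halt hnondeg hn v (hEP v)
      inv (hinv v), LocalInvariants.mem_dualTransported_iff] at h
    exact h

include halt in
/-- **`θ⁻¹_*` maps `H¹_{𝓚^*}(K, E[n]^D)` into `H¹_𝓚(K, E[n])`** (odd prime power `n`). [folklore] -/
theorem map_weilDualInv_mem_selmerGroup_kummer (hn : IsPrimePow n) (hodd : Odd n)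
    (inv : LocalInvariants K n) (hinv : ∀ v : HeightOneSpectrum (𝓞 K), Injective (inv (Sum.inr v)))
    (hEP : ∀ v : HeightOneSpectrum (𝓞 K), localEulerPoincareCharacteristic (v.adicCompletion K))
    {y : galoisCohomology ((W.torsionGaloisModule n).tateDual n) 1}
    (hy : y ∈ (inv.dualSelmerStructure (W.torsionGaloisModule n) (W.kummerSelmerStructure n)).selmerGroup) :
    galoisCohomology.map (weilDualInv W n e hμ hadd₁ hadd₂ hgal hnondeg) 1 y ∈
      (W.kummerSelmerStructure n).selmerGroup := by
  rw [SelmerStructure.mem_selmerGroup_iff] at hy ⊢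
  intro v
  rw [localization_map_one']
  rcases v with w | v
  · set z := galoisCohomology.map ((weilDualInv W n e hμ hadd₁ hadd₂ hgal hnondeg).restrictField
      (Place.Completion (Sum.inl w : Place K))) 1 (galoisCohomology.localization _ (Sum.inl w) 1 y)
    have h0 : z = 0 :=
      galoisCohomology_one_torsion_eq_zero_infinitePlace_of_odd W w ((Int.odd_coe_nat n).mpr hodd) z
    rw [h0]; exact zero_mem _
  · rw [← dualTransported_kummerSelmerStructure_inr W n e hμ hadd₁ hadd₂ hgal halt hnondeg hn v (hEP v)
      inv (hinv v), LocalInvariants.mem_dualTransported_iff]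
    change galoisCohomology.map ((weilDualIntertwining W n e hμ hadd₁ hadd₂ hgal).restrictField
        (Place.Completion (Sum.inr v))) 1 (galoisCohomology.map ((weilDualInv W n e hμ hadd₁ hadd₂ hgal
          hnondeg).restrictField (Place.Completion (Sum.inr v))) 1 _) ∈ _
    rw [map_weilDual_map_weilDualInv_restrictField]
    exact hy (Sum.inr v)

include hμ hadd₁ hadd₂ hgal halt hnondeg in
/-- **The residual self-duality count `#H¹_𝓚(K, E[n]) = #H¹_{𝓚^*}(K, E[n]^D)`** for the classical
`n`-descent structure, `n` an odd prime power, when `H¹_𝓚(K, E[n]) = Sel^{(n)}(E/K)` is finite: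
`θ_*` and `θ⁻¹_*` are injections `H¹(K, E[n]) ⇄ H¹(K, E[n]^D)` preserving the two Selmer groups.
(Sakamoto Def. 3.9: the classical structure has no exceptional finite place.) [folklore] -/
theorem natCard_selmerGroup_kummer_eq_dual (hn : IsPrimePow n) (hodd : Odd n)
    (inv : LocalInvariants K n) (hinv : ∀ v : HeightOneSpectrum (𝓞 K), Injective (inv (Sum.inr v)))
    (hEP : ∀ v : HeightOneSpectrum (𝓞 K), localEulerPoincareCharacteristic (v.adicCompletion K))
    [Finite (W.kummerSelmerStructure n).selmerGroup] :
    Nat.card (W.kummerSelmerStructure n).selmerGroup =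
      Nat.card (inv.dualSelmerStructure (W.torsionGaloisModule n) (W.kummerSelmerStructure n)).selmerGroup := by
  let f : (W.kummerSelmerStructure n).selmerGroup →
      (inv.dualSelmerStructure (W.torsionGaloisModule n) (W.kummerSelmerStructure n)).selmerGroup :=
    fun x => ⟨_, map_weilDual_mem_dualSelmerGroup W n e hμ hadd₁ hadd₂ hgal halt hnondeg hn hodd inv hinv hEP x.2⟩
  let g : (inv.dualSelmerStructure (W.torsionGaloisModule n) (W.kummerSelmerStructure n)).selmerGroup →
      (W.kummerSelmerStructure n).selmerGroup :=
    fun y => ⟨_, map_weilDualInv_mem_selmerGroup_kummer W n e hμ hadd₁ hadd₂ hgal halt hnondeg hn hodd inv hinv hEP y.2⟩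
  have hf : Injective f := fun x x' h => Subtype.ext
    (map_injective_of_comp_eq _ _ (weilDualInv_weilDualIntertwining W n e hμ hadd₁ hadd₂ hgal hnondeg)
      (congrArg Subtype.val h))
  have hg : Injective g := fun y y' h => Subtype.ext
    (map_injective_of_comp_eq _ _ (weilDualIntertwining_weilDualInv W n e hμ hadd₁ hadd₂ hgal hnondeg)
      (congrArg Subtype.val h))
  haveI : Finite (inv.dualSelmerStructure (W.torsionGaloisModule n) (W.kummerSelmerStructure n)).selmerGroup :=
    Finite.of_injective g hg
  exact le_antisymm (Nat.card_le_card_of_injective f hf) (Nat.card_le_card_of_injective g hg)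

end Summit.BirchSwinnertonDyer.Rank1Residual.GaloisImage

end
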